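import Summits.CriticalPhenomena.SAWScalingLimit.Theses.SAWPhaseRetrieval
import Literature.Probability.LatticeModels.TriangularLatticeProofs
import Literature.Barriers.CriticalPhenomena.ParafermionicHalfCauchyRiemann

/-!
# Retrieval stability, disc case — the lattice potential

For the proof of `SAWPhaseRetrieval.RetrievalStabilityDisc` (stmt-CriticalPhenomena-11413).
If a function `G` on the edges of `ℍ` satisfies the up and down CLOSURE identities
(`G(C a b) + (ζ-1) G(A a b) - ζ G(B a b) = 0`, `G(C a (b+1)) + (ζ-1) G(A a b) - ζ G(B (a+1) b) = 0`,
the Duminil-Copin–Smirnov vertex relations at the faces `(![a,b],0)` and `(![a,b],1)`, see the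
companion Lattice file) on a lattice box `[A, A+M) × [B, B+M)`, then there is a POTENTIAL
`p : ℤ → ℤ → ℂ` on the sites `![a,b]` of the closed box whose increments along the unit edges of
`𝕋` are the edge values times the edge direction:
`p(a+1,b) - p(a,b) = G(C a b)`, `p(a,b+1) - p(a,b) = ζ G(B a b)`, `p(a,b+1) - p(a+1,b) = (ζ-1) G(A a b)`
(directions `1`, `ζ`, `ζ² = ζ - 1`).  In other words every solution of the vertex relations is
the field of discrete derivatives `(p(x') - p(x))/(x' - x)` of a lattice map `p : 𝕋 → ℂ`.
We also record the summed increments along lattice segments in the three directions.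
Edge forms are written out (local notation `EA/EB/EC`), no definitions are introduced.
-/

namespace Summit.CriticalPhenomena.SAWScalingLimit.Theorems

open Literature.Probability.LatticeModels Literature.Barriers.CriticalPhenomena.HexKernel Complex
  Finset

local notation "EA[" a "," b "]" =>
  (s(((![a, b] : Site 2), (0 : Fin 2)), ((![a, b] : Site 2), (1 : Fin 2))) : Sym2 HexVertex)
local notation "EB[" a "," b "]" =>
  (s(((![a, b] : Site 2), (0 : Fin 2)), ((![a - 1, b] : Site 2), (1 : Fin 2))) : Sym2 HexVertex)
local notation "EC[" a "," b "]" =>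
  (s(((![a, b] : Site 2), (0 : Fin 2)), ((![a, b - 1] : Site 2), (1 : Fin 2))) : Sym2 HexVertex)

/-- **Existence of the potential** on the closed box `[A, A+M] × [B, B+M]` from the up/down closure
identities on the cells `[A, A+M) × [B, B+M)`.  Construction: integrate `G(C · B)` along the bottom
row and then `ζ G(B a ·)` up each column; the horizontal and diagonal increments on higher rows
follow by induction from the two closures of each cell. [folklore] -/
theorem rsd_potential_exists (G : Sym2 HexVertex → ℂ) (A B : ℤ) (M : ℕ)
    (hU : ∀ a b : ℤ, A ≤ a → a < A + M → B ≤ b → b < B + M →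
      G EC[a, b] + (triZeta - 1) * G EA[a, b] - triZeta * G EB[a, b] = 0)
    (hD : ∀ a b : ℤ, A ≤ a → a < A + M → B ≤ b → b < B + M →
      G EC[a, b + 1] + (triZeta - 1) * G EA[a, b] - triZeta * G EB[a + 1, b] = 0) :
    ∃ p : ℤ → ℤ → ℂ,
      (∀ a b : ℤ, A ≤ a → a < A + M → B ≤ b → b ≤ B + M → p (a + 1) b - p a b = G EC[a, b]) ∧
      (∀ a b : ℤ, B ≤ b → p a (b + 1) - p a b = triZeta * G EB[a, b]) ∧
      (∀ a b : ℤ, A ≤ a → a < A + M → B ≤ b → b < B + M →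
        p a (b + 1) - p (a + 1) b = (triZeta - 1) * G EA[a, b]) := by
  -- the potential in natural offsets from the corner `(A, B)` (column offset may be any integer)
  set P : ℤ → ℕ → ℂ := fun a j =>
    (∑ k ∈ range (Int.toNat (a - A)), G EC[A + k, B]) +
      triZeta * ∑ k ∈ range j, G EB[a, B + k] with hP
  have hPv : ∀ (a : ℤ) (j : ℕ), P a (j + 1) - P a j = triZeta * G EB[a, B + j] := by
    intro a j
    simp only [hP, sum_range_succ]
    ring
  -- horizontal increments, by induction on the row offset
  have hPh : ∀ j : ℕ, j ≤ M → ∀ i : ℕ, i < M →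
      P (A + i + 1) j - P (A + i) j = G EC[A + i, B + j] := by
    intro j
    induction j with
    | zero =>
      intro _ i _
      have h1 : Int.toNat (A + i + 1 - A) = i + 1 := by
        rw [show A + (i : ℤ) + 1 - A = ((i + 1 : ℕ) : ℤ) by push_cast; ring, Int.toNat_natCast]
      have h2 : Int.toNat (A + i - A) = i := by
        rw [show A + (i : ℤ) - A = ((i : ℕ) : ℤ) by ring, Int.toNat_natCast]
      simp only [hP, h1, h2, sum_range_succ, sum_range_zero, mul_zero, add_zero, Nat.cast_zero]
      ring
    | succ j ih =>
      intro hj i hi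
      have hj' : j ≤ M := Nat.le_of_succ_le hj
      have hjM : (j : ℤ) < M := by exact_mod_cast hj
      have e1 := hPv (A + i + 1) j
      have e2 := hPv (A + i) j
      have e3 := ih hj' i hi
      have hiM : (i : ℤ) < M := by exact_mod_cast hi
      have hu := hU (A + i) (B + j) (by linarith) (by linarith) (by linarith) (by linarith)
      have hd := hD (A + i) (B + j) (by linarith) (by linarith) (by linarith) (by linarith)
      have ec : (B + (j : ℤ) + 1 : ℤ) = B + ((j + 1 : ℕ) : ℤ) := by push_cast; ring
      rw [ec] at hd
      linear_combination e1 - e2 + e3 - hd + hu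
  -- the potential
  refine ⟨fun a b => P a (Int.toNat (b - B)), ?_, ?_, ?_⟩
  · intro a b ha haM hb hbM
    obtain ⟨i, hi⟩ := Int.le.dest ha
    obtain ⟨j, hj⟩ := Int.le.dest hb
    subst hi; subst hj
    have hiM : i < M := by exact_mod_cast (show (i : ℤ) < M by linarith)
    have hjM : j ≤ M := by exact_mod_cast (show (j : ℤ) ≤ M by linarith)
    have h2 : Int.toNat (B + j - B) = j := by
      rw [show B + (j : ℤ) - B = ((j : ℕ) : ℤ) by ring, Int.toNat_natCast]
    simp only [h2]
    exact hPh j hjM i hiM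
  · intro a b hb
    obtain ⟨j, hj⟩ := Int.le.dest hb
    subst hj
    have h1 : Int.toNat (B + j + 1 - B) = j + 1 := by
      rw [show B + (j : ℤ) + 1 - B = ((j + 1 : ℕ) : ℤ) by push_cast; ring, Int.toNat_natCast]
    have h2 : Int.toNat (B + j - B) = j := by
      rw [show B + (j : ℤ) - B = ((j : ℕ) : ℤ) by ring, Int.toNat_natCast]
    simp only [h1, h2]
    exact hPv a j
  · intro a b ha haM hb hbM
    obtain ⟨i, hi⟩ := Int.le.dest ha
    obtain ⟨j, hj⟩ := Int.le.dest hb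
    subst hi; subst hj
    have hiM : i < M := by exact_mod_cast (show (i : ℤ) < M by linarith)
    have hjM : j < M := by exact_mod_cast (show (j : ℤ) < M by linarith)
    have h1 : Int.toNat (B + j + 1 - B) = j + 1 := by
      rw [show B + (j : ℤ) + 1 - B = ((j + 1 : ℕ) : ℤ) by push_cast; ring, Int.toNat_natCast]
    have h2 : Int.toNat (B + j - B) = j := by
      rw [show B + (j : ℤ) - B = ((j : ℕ) : ℤ) by ring, Int.toNat_natCast]
    simp only [h1, h2]
    have e2 := hPv (A + i) j
    have e3 := hPh j hjM.le i hiM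
    have hiM' : (i : ℤ) < M := by exact_mod_cast hiM
    have hjM' : (j : ℤ) < M := by exact_mod_cast hjM
    have hu := hU (A + i) (B + j) (by linarith) (by linarith) (by linarith) (by linarith)
    linear_combination e2 - e3 - hu

/-- Summed horizontal increments: `p(a+n, b) - p(a, b) = Σ_{k<n} G(C (a+k) b)`. [folklore] -/
theorem rsd_sum_horizontal {G : Sym2 HexVertex → ℂ} {p : ℤ → ℤ → ℂ} {A B : ℤ} {M : ℕ}
    (hH : ∀ a b : ℤ, A ≤ a → a < A + M → B ≤ b → b ≤ B + M → p (a + 1) b - p a b = G EC[a, b])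
    (a b : ℤ) (n : ℕ) (ha : A ≤ a) (han : a + n ≤ A + M) (hb : B ≤ b) (hbM : b ≤ B + M) :
    p (a + n) b - p a b = ∑ k ∈ range n, G EC[a + k, b] := by
  induction n with
  | zero => simp
  | succ n ih =>
    have h1 := ih (by push_cast at han ⊢; linarith)
    have h2 := hH (a + n) b (by linarith) (by push_cast at han ⊢; linarith) hb hbM
    rw [sum_range_succ, ← h1, ← h2]
    push_cast
    ring

/-- Summed increments in direction `ζ`: `p(a, b+n) - p(a, b) = ζ Σ_{k<n} G(B a (b+k))`. [folklore] -/
theorem rsd_sum_vertical {G : Sym2 HexVertex → ℂ} {p : ℤ → ℤ → ℂ} {B : ℤ}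
    (hV : ∀ a b : ℤ, B ≤ b → p a (b + 1) - p a b = triZeta * G EB[a, b])
    (a b : ℤ) (n : ℕ) (hb : B ≤ b) :
    p a (b + n) - p a b = triZeta * ∑ k ∈ range n, G EB[a, b + k] := by
  induction n with
  | zero => simp
  | succ n ih =>
    have h2 := hV a (b + n) (by linarith)
    rw [sum_range_succ, mul_add, ← ih, ← h2]
    push_cast
    ring

/-- Summed increments in direction `ζ² = ζ - 1` (up-left):
`p(a-n, b+n) - p(a, b) = (ζ-1) Σ_{k<n} G(A (a-k-1) (b+k))`. [folklore] -/
theorem rsd_sum_diagonal {G : Sym2 HexVertex → ℂ} {p : ℤ → ℤ → ℂ} {A B : ℤ} {M : ℕ}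
    (hDg : ∀ a b : ℤ, A ≤ a → a < A + M → B ≤ b → b < B + M →
      p a (b + 1) - p (a + 1) b = (triZeta - 1) * G EA[a, b])
    (a b : ℤ) (n : ℕ) (ha : A ≤ a - n) (haM : a ≤ A + M) (hb : B ≤ b) (hbn : b + n ≤ B + M) :
    p (a - n) (b + n) - p a b = (triZeta - 1) * ∑ k ∈ range n, G EA[a - k - 1, b + k] := by
  induction n with
  | zero => simp
  | succ n ih =>
    have h1 := ih (by push_cast at ha ⊢; linarith) (by push_cast at hbn ⊢; linarith)
    have h2 := hDg (a - n - 1) (b + n) (by push_cast at ha ⊢; linarith) (by linarith) (by linarith)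
      (by push_cast at hbn ⊢; linarith)
    have e : (a - n - 1 + 1 : ℤ) = a - n := by ring
    rw [e] at h2
    rw [sum_range_succ, mul_add, ← h1, ← h2]
    push_cast
    ring

end Summit.CriticalPhenomena.SAWScalingLimit.Theorems
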